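import Literature.Computability.AlgebraicComplexity.CwSquareGenericTables
import HarnessLib

/-!
# Transfer of the peeling conditions from `q = 9` to every `q ≥ 5` (renaming of generic indices)

Topic: `Literature/Computability/AlgebraicComplexity`. Step F3 of the general case of the square part
of Conner–Gesmundo–Landsberg–Ventura 2022, Thm. 1.2 (`CwSquareGenericPhi.lean`, `CwSquareGenericTables.lean`).
The local peeling conditions `CwSqGen.GoodAt q` involve at most one row and one column of the
flattening at a time, i.e. at most four indices `c₁, c₂, b₁, b₂ ∈ {0,…,q}`. Renaming the generic
ones (those `≥ 6`) order-preservingly into `{6, 7, 8, 9}` and fixing the special ones does not change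
any entry of the flattening (the restriction `φ` and the support function `α` of `T_{cw,q}` only
see comparisons with constants `≤ 5` and equalities) nor any pivot datum (the tables only see
classes, the equality flag and plumbing). Hence `GoodAt 9` (verified by the kernel) implies
`GoodAt q` for all `q ≥ 5`. Everything here is **proved**:

* `CwSqGen.renN G`, `CwSqGen.renF G` — the renaming attached to a finite set `G` of generic values
  (`x ↦ 6 + #{g ∈ G | g < x}` on generic `x`), its injectivity on covered indices and the
  preservation lemmas (`renN_eq_iff`, `le_renN_iff`, `clsNat_renN`, `eqFlag_renN`, `gphi_renN`,
  `cwAlpha_renF`, `phiVal_renF`, `kgen_ren`, `rowInfo_ren`, `colInfo_ren`).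
* `CwSqGen.goodAt_of_five_le : 5 ≤ q → GoodAt q`.

## References

* A. Conner, F. Gesmundo, J. M. Landsberg, E. Ventura, *Rank and border rank of Kronecker powers of
  tensors and Strassen's laser method*, comput. complexity 31 (2022), arXiv:1909.04785, Thm. 1.2, §4.3,
  and §7 ("box parameterized" tensors: entries depend on `q` only through a bounded pattern).
  [ConnerGesmundoLandsbergVentura2022]
-/

open scoped BigOperators

namespace Literature.Computability.AlgebraicComplexity

namespace CwSqGen

/-! ## Renaming of generic indices (on `ℕ`) -/

/-- The renaming attached to a finite set `G` of generic values: special values (`< 6`) are fixed,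
a generic value `x` goes to `6 + #{g ∈ G | g < x}`. [folklore] -/
def renN (G : Finset ℕ) (x : ℕ) : ℕ := if x < 6 then x else 6 + (G.filter (· < x)).card

/-- `x` is covered by `G`: special, or a member of `G`. [folklore] -/
def Cov (G : Finset ℕ) (x : ℕ) : Prop := x < 6 ∨ x ∈ G

variable {G : Finset ℕ}

/-- Special values are fixed. [folklore] -/
theorem renN_of_lt {x : ℕ} (h : x < 6) : renN G x = x := by simp [renN, h]

/-- Generic values stay generic. [folklore] -/
theorem six_le_renN {x : ℕ} (h : 6 ≤ x) : 6 ≤ renN G x := by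
  simp [renN, not_lt.2 h]

/-- Members of `G` land below `6 + #G`. [folklore] -/
theorem renN_le {x : ℕ} (hG : G.card ≤ 4) (hx : x ∈ G) : renN G x ≤ 9 := by
  unfold renN
  split_ifs
  · omega
  · have h : (G.filter (· < x)).card ≤ (G.erase x).card :=
      Finset.card_le_card fun y hy => by
        rw [Finset.mem_filter] at hy
        exact Finset.mem_erase.2 ⟨hy.2.ne, hy.1⟩
    rw [Finset.card_erase_of_mem hx] at h
    omega

/-- The renaming is strictly increasing on generic members of `G`. [folklore] -/
theorem renN_lt_renN {x y : ℕ} (hx : x ∈ G) (h6 : 6 ≤ x) (hxy : x < y) : renN G x < renN G y := by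
  unfold renN
  rw [if_neg (by omega), if_neg (by omega)]
  have hss : G.filter (· < x) ⊂ G.filter (· < y) := by
    rw [Finset.ssubset_iff_of_subset (fun z hz => by
      rw [Finset.mem_filter] at hz ⊢
      exact ⟨hz.1, hz.2.trans hxy⟩)]
    exact ⟨x, by simp [hx, hxy], by simp⟩
  have := Finset.card_lt_card hss
  omega

/-- The renaming is injective on covered values. [folklore] -/
theorem renN_injOn {x y : ℕ} (hx : Cov G x) (hy : Cov G y) (h : renN G x = renN G y) : x = y := by
  rcases Nat.lt_or_ge x 6 with h1 | h1 <;> rcases Nat.lt_or_ge y 6 with h2 | h2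
  · rwa [renN_of_lt h1, renN_of_lt h2] at h
  · exfalso
    rw [renN_of_lt h1] at h
    have := six_le_renN (G := G) h2
    omega
  · exfalso
    rw [renN_of_lt h2] at h
    have := six_le_renN (G := G) h1
    omega
  · have hxG : x ∈ G := hx.resolve_left (by omega)
    have hyG : y ∈ G := hy.resolve_left (by omega)
    rcases lt_trichotomy x y with hlt | rfl | hgt
    · exact absurd h (renN_lt_renN hxG h1 hlt).ne
    · rfl
    · exact absurd h (renN_lt_renN hyG h2 hgt).ne'

/-- `renN x = renN y ↔ x = y` on covered values. [folklore] -/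
theorem renN_eq_renN_iff {x y : ℕ} (hx : Cov G x) (hy : Cov G y) : renN G x = renN G y ↔ x = y :=
  ⟨renN_injOn hx hy, fun h => by rw [h]⟩

/-- Comparison with a special constant is preserved: `renN x = k ↔ x = k` (`k < 6`). [folklore] -/
theorem renN_eq_iff {x : ℕ} (k : ℕ) (hk : k < 6) : renN G x = k ↔ x = k := by
  rcases Nat.lt_or_ge x 6 with h | h
  · rw [renN_of_lt h]
  · have := six_le_renN (G := G) h
    constructor <;> intro e <;> omega

/-- `k ≤ renN x ↔ k ≤ x` (`k ≤ 6`). [folklore] -/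
theorem le_renN_iff {x : ℕ} (k : ℕ) (hk : k ≤ 6) : k ≤ renN G x ↔ k ≤ x := by
  rcases Nat.lt_or_ge x 6 with h | h
  · rw [renN_of_lt h]
  · have := six_le_renN (G := G) h
    constructor <;> intro <;> omega

/-- `renN x ≤ k ↔ x ≤ k` (`k < 6`). [folklore] -/
theorem renN_le_iff {x : ℕ} (k : ℕ) (hk : k < 6) : renN G x ≤ k ↔ x ≤ k := by
  rcases Nat.lt_or_ge x 6 with h | h
  · rw [renN_of_lt h]
  · have := six_le_renN (G := G) h
    constructor <;> intro <;> omega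

/-- `renN x < k ↔ x < k` (`k ≤ 6`). [folklore] -/
theorem renN_lt_iff {x : ℕ} (k : ℕ) (hk : k ≤ 6) : renN G x < k ↔ x < k := by
  rcases Nat.lt_or_ge x 6 with h | h
  · rw [renN_of_lt h]
  · have := six_le_renN (G := G) h
    constructor <;> intro <;> omega

/-- Classes are preserved. [folklore] -/
theorem clsNat_renN (x : ℕ) : clsNat (renN G x) = clsNat x := by
  unfold clsNat
  by_cases h : x < 6
  · simp [renN_of_lt h, h]
  · have h' : ¬ renN G x < 6 := not_lt.2 (six_le_renN (not_lt.1 h))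
    simp [h, h']

/-- The equality flag is preserved on covered values. [folklore] -/
theorem eqFlag_renN {x y : ℕ} (hx : Cov G x) (hy : Cov G y) :
    eqFlag (renN G x) (renN G y) = eqFlag x y := by
  unfold eqFlag
  simp only [le_renN_iff 6 le_rfl, renN_eq_renN_iff hx hy]

/-- The restriction `φ` is preserved on covered values. [cite: ConnerGesmundoLandsbergVentura2022, §4.3] -/
theorem gphi_renN (j : Fin 3) {x y : ℕ} (hx : Cov G x) (hy : Cov G y) :
    gphi j (renN G x) (renN G y) = gphi j x y := by
  have e1 := renN_le_iff (G := G) (x := x) 1 (by norm_num)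
  have e2 := renN_le_iff (G := G) (x := y) 1 (by norm_num)
  have e3 := fun k (hk : k < 6) => renN_eq_iff (G := G) (x := x) k hk
  have e4 := fun k (hk : k < 6) => renN_eq_iff (G := G) (x := y) k hk
  have e5 := le_renN_iff (G := G) (x := x) 4 (by norm_num)
  have e6 := le_renN_iff (G := G) (x := y) 4 (by norm_num)
  have e7 := renN_eq_renN_iff hx hy
  fin_cases j <;>
    simp only [gphi, e1, e2, e3 0 (by norm_num), e3 1 (by norm_num), e3 2 (by norm_num),
      e3 3 (by norm_num), e4 0 (by norm_num), e4 1 (by norm_num), e4 2 (by norm_num),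
      e4 3 (by norm_num), e5, e6, e7]

/-! ## Renaming on `Fin`, rows and columns -/

variable {q : ℕ}

/-- The renaming as a map `Fin (q+1) → Fin 10` (clamped; exact on covered values when `#G ≤ 4`).
[folklore] -/
def renF (G : Finset ℕ) (x : Fin (q + 1)) : Fin 10 := ⟨min (renN G x.val) 9, by omega⟩

/-- On covered values the clamp is inactive. [folklore] -/
theorem renF_val (hG : G.card ≤ 4) {x : Fin (q + 1)} (hx : Cov G x.val) :
    (renF G x).val = renN G x.val := by
  show min (renN G x.val) 9 = renN G x.val
  rcases hx with h | h
  · rw [renN_of_lt h]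
    omega
  · exact Nat.min_eq_left (renN_le hG h)

/-- `renF x = renF y ↔ x = y` on covered values. [folklore] -/
theorem renF_eq_renF_iff (hG : G.card ≤ 4) {x y : Fin (q + 1)} (hx : Cov G x.val)
    (hy : Cov G y.val) : renF G x = renF G y ↔ x = y := by
  rw [Fin.ext_iff, renF_val hG hx, renF_val hG hy, renN_eq_renN_iff hx hy, Fin.ext_iff]

/-- `renF x = 0 ↔ x = 0` on covered values. [folklore] -/
theorem renF_eq_zero_iff (hG : G.card ≤ 4) {x : Fin (q + 1)} (hx : Cov G x.val) :
    renF G x = 0 ↔ x = 0 := by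
  rw [Fin.ext_iff, renF_val hG hx, Fin.val_zero, renN_eq_iff 0 (by norm_num), Fin.ext_iff,
    Fin.val_zero]

/-- `renF 0 = 0`. [folklore] -/
theorem renF_zero : renF G (0 : Fin (q + 1)) = 0 := by
  apply Fin.ext
  show min (renN G 0) 9 = 0
  rw [renN_of_lt (by norm_num)]
  rfl

/-- Renaming a row. [folklore] -/
def renRow (G : Finset ℕ) (r : Row q) : Row 9 := (r.1, (renF G r.2.1, renF G r.2.2))

/-- Renaming a column. [folklore] -/
def renCol (G : Finset ℕ) (c : Col q) : Col 9 := (c.1, (renF G c.2.1, renF G c.2.2))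

/-- Both indices of a pair are covered. [folklore] -/
def Cov2 (G : Finset ℕ) (x : Fin (q + 1) × Fin (q + 1)) : Prop := Cov G x.1.val ∧ Cov G x.2.val

/-- `renRow` is injective on covered rows. [folklore] -/
theorem renRow_injOn (hG : G.card ≤ 4) {r r' : Row q} (hr : Cov2 G r.2) (hr' : Cov2 G r'.2)
    (h : renRow G r = renRow G r') : r = r' := by
  simp only [renRow, Prod.mk.injEq] at h
  obtain ⟨h1, h2, h3⟩ := h
  rw [renF_eq_renF_iff hG hr.1 hr'.1] at h2
  rw [renF_eq_renF_iff hG hr.2 hr'.2] at h3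
  exact Prod.ext h1 (Prod.ext h2 h3)

/-- `renCol` is injective on covered columns. [folklore] -/
theorem renCol_injOn (hG : G.card ≤ 4) {c c' : Col q} (hc : Cov2 G c.2) (hc' : Cov2 G c'.2)
    (h : renCol G c = renCol G c') : c = c' :=
  renRow_injOn hG hc hc' h

/-! ## Preservation of the pivot data -/

/-- Plumbing commutes with renaming (for `q ≥ 5`, so that the constants `≤ 5` are genuine). [folklore] -/
theorem plumbApply_renF (hG : G.card ≤ 4) (hq : 5 ≤ q) (p : Fin 8) (x₁ x₂ : Fin (q + 1)) :
    plumbApply p (renF G x₁) (renF G x₂) = renF G (plumbApply p x₁ x₂) := by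
  unfold plumbApply
  by_cases hp : p.val < 6
  · rw [if_pos hp, if_pos hp]
    apply Fin.ext
    have hcov : Cov G (⟨min p.val q, by omega⟩ : Fin (q + 1)).val := Or.inl (by simp; omega)
    rw [renF_val hG hcov]
    simp only
    rw [renN_of_lt (by omega)]
    omega
  · rw [if_neg hp, if_neg hp]
    split_ifs <;> rfl

/-- Plumbed indices are covered. [folklore] -/
theorem cov_plumbApply (p : Fin 8) {x₁ x₂ : Fin (q + 1)} (h₁ : Cov G x₁.val) (h₂ : Cov G x₂.val) :
    Cov G (plumbApply p x₁ x₂).val := by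
  unfold plumbApply
  split_ifs
  · exact Or.inl (by simp; omega)
  · exact h₁
  · exact h₂

/-- Row pivot data are preserved by renaming, and partners are covered. [folklore] -/
theorem rowInfo_ren (hG : G.card ≤ 4) (hq : 5 ≤ q) {r : Row q} (hr : Cov2 G r.2) :
    rowInfo (renRow G r) = (rowInfo r).map (fun x => (x.1, x.2.1, renCol G x.2.2)) ∧
      ∀ i k pc, rowInfo r = some (i, k, pc) → Cov2 G pc.2 := by
  unfold rowInfo renRow
  simp only
  rw [renF_val hG hr.1, renF_val hG hr.2, clsNat_renN, clsNat_renN, eqFlag_renN hr.1 hr.2]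
  cases rowTab r.1 (clsNat r.2.1.val) (clsNat r.2.2.val) (eqFlag r.2.1.val r.2.2.val) with
  | none => exact ⟨rfl, fun i k pc h => by simp at h⟩
  | some v =>
    obtain ⟨i, k, s, p₁, p₂⟩ := v
    refine ⟨?_, fun i' k' pc h => ?_⟩
    · simp only [Option.map_some, renCol, plumbApply_renF hG hq]
    · simp only [Option.some.injEq, Prod.mk.injEq] at h
      obtain ⟨-, -, rfl⟩ := h
      exact ⟨cov_plumbApply p₁ hr.1 hr.2, cov_plumbApply p₂ hr.1 hr.2⟩

/-- Column pivot data are preserved by renaming, and partners are covered. [folklore] -/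
theorem colInfo_ren (hG : G.card ≤ 4) (hq : 5 ≤ q) {c : Col q} (hc : Cov2 G c.2) :
    colInfo (renCol G c) = (colInfo c).map (fun x => (x.1, x.2.1, renRow G x.2.2)) ∧
      ∀ i k pr, colInfo c = some (i, k, pr) → Cov2 G pr.2 := by
  unfold colInfo renCol
  simp only
  rw [renF_val hG hc.1, renF_val hG hc.2, clsNat_renN, clsNat_renN, eqFlag_renN hc.1 hc.2]
  cases colTab c.1 (clsNat c.2.1.val) (clsNat c.2.2.val) (eqFlag c.2.1.val c.2.2.val) with
  | none => exact ⟨rfl, fun i k pr h => by simp at h⟩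
  | some v =>
    obtain ⟨i, k, t, p₁, p₂⟩ := v
    refine ⟨?_, fun i' k' pr h => ?_⟩
    · simp only [Option.map_some, renRow, plumbApply_renF hG hq]
    · simp only [Option.some.injEq, Prod.mk.injEq] at h
      obtain ⟨-, -, rfl⟩ := h
      exact ⟨cov_plumbApply p₁ hc.1 hc.2, cov_plumbApply p₂ hc.1 hc.2⟩

/-! ## Preservation of the entries -/

/-- The support function `α` commutes with renaming. [folklore] -/
theorem cwAlpha_renF (hG : G.card ≤ 4) {b c : Fin (q + 1)} (hb : Cov G b.val) (hc : Cov G c.val) :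
    cwAlpha 9 (renF G b) (renF G c) = (cwAlpha q b c).map (renF G) := by
  unfold cwAlpha
  simp only [ne_eq, renF_eq_renF_iff hG hb hc, renF_eq_zero_iff hG hb, renF_eq_zero_iff hG hc]
  split_ifs <;> simp [renF_zero]

/-- Values of `α` are covered. [folklore] -/
theorem cov_of_cwAlpha {b c x : Fin (q + 1)} (hb : Cov G b.val) (hc : Cov G c.val)
    (h : cwAlpha q b c = some x) : Cov G x.val := by
  unfold cwAlpha at h
  split_ifs at h with h1 h2 h3
  · cases h
    exact Or.inl (by simp)
  · cases h
    exact hc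
  · cases h
    exact hb

/-- Slice values are preserved. [folklore] -/
theorem phiVal_renF (hG : G.card ≤ 4) (j : Fin 3) {b c : Fin (q + 1) × Fin (q + 1)}
    (hb : Cov2 G b) (hc : Cov2 G c) :
    phiVal (genM 9) j (renF G b.1, renF G b.2) (renF G c.1, renF G c.2) = phiVal (genM q) j b c := by
  unfold phiVal
  simp only
  rw [cwAlpha_renF hG hb.1 hc.1, cwAlpha_renF hG hb.2 hc.2]
  rcases h1 : cwAlpha q b.1 c.1 with _ | x <;> rcases h2 : cwAlpha q b.2 c.2 with _ | y <;>
    simp only [Option.map_some, Option.map_none]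
  simp only [genM_apply]
  rw [renF_val hG (cov_of_cwAlpha hb.1 hc.1 h1), renF_val hG (cov_of_cwAlpha hb.2 hc.2 h2),
    gphi_renN j (cov_of_cwAlpha hb.1 hc.1 h1) (cov_of_cwAlpha hb.2 hc.2 h2)]

/-- **Entries are preserved**: `kgen 9 (renRow r) (renCol c) = kgen q r c` when `G` covers the four
indices. [cite: ConnerGesmundoLandsbergVentura2022, §4.3] -/
theorem kgen_ren (hG : G.card ≤ 4) {r : Row q} {c : Col q} (hr : Cov2 G r.2) (hc : Cov2 G c.2) :
    kgen 9 (renRow G r) (renCol G c) = kgen q r c := by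
  unfold kgen renRow renCol
  exact Finset.sum_congr rfl fun j _ => by rw [phiVal_renF hG j hc hr]

/-! ## The transfer -/

/-- The generic members of four values. [folklore] -/
def gens (a b c d : ℕ) : Finset ℕ := ({a, b, c, d} : Finset ℕ).filter (6 ≤ ·)

/-- At most four generic members. [folklore] -/
theorem card_gens_le (a b c d : ℕ) : (gens a b c d).card ≤ 4 := by
  unfold gens
  refine (Finset.card_filter_le _ _).trans ?_
  refine (Finset.card_insert_le _ _).trans ?_
  refine Nat.succ_le_succ ((Finset.card_insert_le _ _).trans ?_)
  refine Nat.succ_le_succ ((Finset.card_insert_le _ _).trans ?_)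
  simp

/-- Each of the four values is covered. [folklore] -/
theorem cov_gens (a b c d x : ℕ) (hx : x = a ∨ x = b ∨ x = c ∨ x = d) : Cov (gens a b c d) x := by
  by_cases h : x < 6
  · exact Or.inl h
  · refine Or.inr ?_
    simp only [gens, Finset.mem_filter, Finset.mem_insert, Finset.mem_singleton]
    exact ⟨hx, not_lt.1 h⟩

/-- **Transfer.** The local peeling conditions at `q = 9` imply them at every `q ≥ 5`.
[cite: ConnerGesmundoLandsbergVentura2022, Thm. 1.2] -/
theorem goodAt_of_five_le (hq : 5 ≤ q) : GoodAt q := by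
  obtain ⟨h9r, h9c⟩ := goodAt_nine
  constructor
  · -- rows
    intro r
    unfold rowOkB
    rcases hri : rowInfo r with _ | ⟨i, k, pc⟩
    · rfl
    · simp only [Bool.and_eq_true, decide_eq_true_eq, Bool.or_eq_true, Bool.not_eq_true']
      -- renaming for the pair (r, pc): `pc` is plumbed from `r`, so `G₀` covering `r` suffices
      set G₀ := gens r.2.1.val r.2.2.val 0 0 with hG₀
      have hG₀c : G₀.card ≤ 4 := card_gens_le _ _ _ _
      have hr₀ : Cov2 G₀ r.2 := ⟨cov_gens _ _ _ _ _ (Or.inl rfl), cov_gens _ _ _ _ _ (Or.inr (Or.inl rfl))⟩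
      obtain ⟨hinfo₀, hcov₀⟩ := rowInfo_ren hG₀c hq hr₀
      have hpc₀ : Cov2 G₀ pc.2 := hcov₀ i k pc hri
      rw [hri, Option.map_some] at hinfo₀
      obtain ⟨h1, h2, h3, h4⟩ := rowOkB_spec (h9r (renRow G₀ r)) hinfo₀
      refine ⟨⟨⟨?_, ?_⟩, h3⟩, ?_⟩
      · -- mutual inverse
        obtain ⟨hcinfo₀, hccov₀⟩ := colInfo_ren hG₀c hq hpc₀
        rw [hcinfo₀] at h1
        rcases hci : colInfo pc with _ | ⟨i', k', pr⟩
        · rw [hci] at h1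
          simp at h1
        · rw [hci, Option.map_some] at h1
          simp only [Option.some.injEq, Prod.mk.injEq] at h1
          obtain ⟨hi, hk, h1⟩ := h1
          have hpr : Cov2 G₀ pr.2 := hccov₀ _ _ pr hci
          rw [hi, hk, renRow_injOn hG₀c hpr hr₀ h1]
      · -- non-zero pivot entry
        rwa [kgen_ren hG₀c hr₀ hpc₀] at h2
      · -- other entries of a row-round row
        rcases Bool.eq_false_or_eq_true k with hk | hk
        · refine Or.inr fun c hne => ?_
          -- renaming for the four indices of `r` and `c`
          set G := gens r.2.1.val r.2.2.val c.2.1.val c.2.2.val with hGdef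
          have hGc : G.card ≤ 4 := card_gens_le _ _ _ _
          have hr' : Cov2 G r.2 :=
            ⟨cov_gens _ _ _ _ _ (Or.inl rfl), cov_gens _ _ _ _ _ (Or.inr (Or.inl rfl))⟩
          have hc' : Cov2 G c.2 := ⟨cov_gens _ _ _ _ _ (Or.inr (Or.inr (Or.inl rfl))),
            cov_gens _ _ _ _ _ (Or.inr (Or.inr (Or.inr rfl)))⟩
          obtain ⟨hinfo, hcov⟩ := rowInfo_ren hGc hq hr'
          have hpc : Cov2 G pc.2 := hcov i k pc hri
          rw [hri, Option.map_some] at hinfo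
          obtain ⟨-, -, -, h4'⟩ := rowOkB_spec (h9r (renRow G r)) hinfo
          have hne' : kgen 9 (renRow G r) (renCol G c) ≠ 0 := by rwa [kgen_ren hGc hr' hc']
          rcases h4' hk (renCol G c) hne' with h5 | h5
          · exact Or.inl (renCol_injOn hGc hc' hpc h5)
          · refine Or.inr ?_
            unfold colRoundLt at h5 ⊢
            obtain ⟨hcinfo, -⟩ := colInfo_ren hGc hq hc'
            rw [hcinfo] at h5
            rcases hci : colInfo c with _ | ⟨i', k', pr⟩
            · rw [hci] at h5
              simp at h5
            · rw [hci, Option.map_some] at h5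
              exact h5
        · exact Or.inl hk
  · -- columns
    intro c
    unfold colOkB
    rcases hci : colInfo c with _ | ⟨i, k, pr⟩
    · rfl
    · simp only [Bool.and_eq_true, decide_eq_true_eq, Bool.or_eq_true]
      set G₀ := gens c.2.1.val c.2.2.val 0 0 with hG₀
      have hG₀c : G₀.card ≤ 4 := card_gens_le _ _ _ _
      have hc₀ : Cov2 G₀ c.2 := ⟨cov_gens _ _ _ _ _ (Or.inl rfl), cov_gens _ _ _ _ _ (Or.inr (Or.inl rfl))⟩
      obtain ⟨hinfo₀, hcov₀⟩ := colInfo_ren hG₀c hq hc₀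
      have hpr₀ : Cov2 G₀ pr.2 := hcov₀ i k pr hci
      rw [hci, Option.map_some] at hinfo₀
      obtain ⟨h1, h2, h3⟩ := colOkB_spec (h9c (renCol G₀ c)) hinfo₀
      refine ⟨⟨?_, h2⟩, ?_⟩
      · obtain ⟨hrinfo₀, hrcov₀⟩ := rowInfo_ren hG₀c hq hpr₀
        rw [hrinfo₀] at h1
        rcases hri : rowInfo pr with _ | ⟨i', k', pc⟩
        · rw [hri] at h1
          simp at h1
        · rw [hri, Option.map_some] at h1
          simp only [Option.some.injEq, Prod.mk.injEq] at h1
          obtain ⟨hi, hk, h1⟩ := h1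
          have hpc : Cov2 G₀ pc.2 := hrcov₀ _ _ pc hri
          rw [hi, hk, renCol_injOn hG₀c hpc hc₀ h1]
      · rcases Bool.eq_false_or_eq_true k with hk | hk
        · exact Or.inl hk
        · refine Or.inr fun r hne => ?_
          set G := gens c.2.1.val c.2.2.val r.2.1.val r.2.2.val with hGdef
          have hGc : G.card ≤ 4 := card_gens_le _ _ _ _
          have hc' : Cov2 G c.2 :=
            ⟨cov_gens _ _ _ _ _ (Or.inl rfl), cov_gens _ _ _ _ _ (Or.inr (Or.inl rfl))⟩
          have hr' : Cov2 G r.2 := ⟨cov_gens _ _ _ _ _ (Or.inr (Or.inr (Or.inl rfl))),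
            cov_gens _ _ _ _ _ (Or.inr (Or.inr (Or.inr rfl)))⟩
          obtain ⟨hinfo, hcov⟩ := colInfo_ren hGc hq hc'
          have hpr : Cov2 G pr.2 := hcov i k pr hci
          rw [hci, Option.map_some] at hinfo
          obtain ⟨-, -, h3'⟩ := colOkB_spec (h9c (renCol G c)) hinfo
          have hne' : kgen 9 (renRow G r) (renCol G c) ≠ 0 := by rwa [kgen_ren hGc hr' hc']
          rcases h3' hk (renRow G r) hne' with h5 | h5
          · exact Or.inl (renRow_injOn hGc hr' hpr h5)
          · refine Or.inr ?_
            unfold rowRoundLt at h5 ⊢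
            obtain ⟨hrinfo, -⟩ := rowInfo_ren hGc hq hr'
            rw [hrinfo] at h5
            rcases hri : rowInfo r with _ | ⟨i', k', pc⟩
            · rw [hri] at h5
              simp at h5
            · rw [hri, Option.map_some] at h5
              exact h5

end CwSqGen

end Literature.Computability.AlgebraicComplexity
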